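import Summits.QuantumFields.BalabanUV.Beta.GAN24.ContactRefinePThree

/-!
# `BalabanUV.Beta.GAN24.ContactRefinePThreePack` — binder row G-an2-4 / (CONV-C), the row owner's CONTACT-TERM ROUTE, CT-4c SHAPE P at `d = 3`, PACKAGED
# (road-P2 chair): the letters of `ContactRefinePThree.abs_pairingAtom_refine_le` DISCHARGED at one common rate from `2 ≤ Lc` alone, and the power count —
# **`|Lc^{12(k+2)}·P′ − Lc^{12(k+1)}·P| ≤ K·θP^k·e^{−(κ₀∕12)(‖z₁−zt‖∞+‖z₂−zt‖∞)}`** for every in-block root, every `k`, every three source bonds, every bond reading,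
# every direction; `θP = max(θ_{CT-4a}, θ_K, 3∕(2Lc)) < 1` (the design's `θS`-class for the P-atoms; the `(k+2)·Lc^{−(k+1)}` log of (δ) absorbed by `3∕(2Lc)`).

NOT IN PRINT; OUR BOOKKEEPING (road-P2 chair `b2b-balaban-gan24-p2`, gen 34; «MINE (CT-4c-P)»; leaf-02 g50's symmetric division W-leaf02-g50-5).  [folklore] packaging
of the parametric END with leaf-12's (N1) `RespStepDecay.exists_respStep_decay_and_grad`, the owner's CT-4a `RespStepCauchy.exists_respStep_cauchy`, d4-p3's I1
`RemainderExplicitMultiplier.exists_wΦ_decay` (+ an2's `abs_contourSumAdj_le`, translated), CT-4d `ContactTentCauchy.exists_unitTent_letters_three`; power algebra and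
leaf-02's `ContactOneGaugeCellBound.tsum_env3_le`.  HONEST FRAMING (cell contract, verbatim): «discharging `BetaPertH` makes Bałaban's UV stability UNCONDITIONAL — a real
constructive-QFT result; it is NOT the continuum limit and NOT the Clay problem.»  HONEST DEPENDENCY (verbatim): «continuum YM on T⁴ ⇐ BetaPertH ∧ nine spine estimates
(0/9 proved); BetaPertH ⇐ (D1) ∧ (D4) ∧ CAP+tail; G-an2-4 gates asym, D1 and NE2/3/4.»  0 `def`, 0 cited facts, 0 `def … : Prop`, 0 sorry; NO new estimate; discharges
NOTHING of hSdev by itself (CT-4e sums the atoms per cell with leaf-02's B-atom END); NEVER «G-an2-4 closed»; NOT (CONV-C) as typed, NOT D1, NOT BetaPertH, NOT continuum,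
NOT Clay.
-/

noncomputable section

open Finset
open scoped BigOperators
open Literature.MathematicalPhysics.QuantumFieldTheory
open Literature.MathematicalPhysics.QuantumFieldTheory.LatticeForm (quo)
open Literature.MathematicalPhysics.QuantumFieldTheory.Balaban1983to89
open Literature.MathematicalPhysics.QuantumFieldTheory.Balaban1983to89.Beta
open B12Sec2to5 (l1 l1_nonneg)
open B4ContourShift (supNorm supNorm_nonneg)
open ExpKernelCalculus (Zl Zl_nonneg)
open KernelSpecInstance (wΦ)
open AffineAveraging (Form0 Form1 Site box toSite unitVec)
open AffineReproduction (contourSumAdj)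
open AveragingContours (blk)
open KKTFluctuationKernel (delta1)
open BalabanCompositeJets (respStep)
open Summit.QuantumFields.BalabanUV.Beta.AxialProjectorBlockMean (bmGaugeAt)
open Summit.QuantumFields.BalabanUV.Beta.GAN24.RespStepBmDecompPsi (Psi)
open Summit.QuantumFields.BalabanUV.Beta.GAN24.RespStepDecay (exists_respStep_decay_and_grad)
open Summit.QuantumFields.BalabanUV.Beta.GAN24.RespStepCauchy (exists_respStep_cauchy supNorm_le_l1)
open Summit.QuantumFields.BalabanUV.Beta.GAN24.UndressedResponseUnits (inv_cast_pow_pow)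
open Summit.QuantumFields.BalabanUV.Beta.RemainderExplicitMultiplier (exists_wΦ_decay)
open Summit.QuantumFields.BalabanUV.Beta.RemainderExplicitLaplacian (abs_contourSumAdj_le)
open Summit.QuantumFields.BalabanUV.Beta.GAN24.ContactPartnerLetters (contourSumAdj_sub_zsmul quo_sub_zsmul')
open Summit.QuantumFields.BalabanUV.Beta.GAN24.ContactTentCauchy (exists_unitTent_letters_three)
open Summit.QuantumFields.BalabanUV.Beta.GAN24.ContactOneGaugeCellBound (tsum_env3_le)
open Summit.QuantumFields.BalabanUV.Beta.GAN24.ContactRefinePWeights (succ_mul_inv_pow_le three_div_two_mul_lt_one)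
open Summit.QuantumFields.BalabanUV.Beta.GAN24.ContactRefinePThree (abs_pairingAtom_refine_le)

namespace Summit.QuantumFields.BalabanUV.Beta.GAN24.ContactRefinePThreePack

variable {Lc : ℕ} [NeZero Lc]

/-! ## §1 The five letter families at one common rate -/

/-- NOT IN PRINT; OUR BOOKKEEPING.  **THE LETTERS OF THE DIFFERENCED P-ATOM AT ONE RATE** (`d = 3`, `2 ≤ Lc`): `∃ κ₀ > 0` and `C c θ Φ₀ cT θK` with (a) leaf-12's (N1) at every
base, (b) the owner's CT-4a top-aligned Cauchy letter, (c) d4-p3's I1 translated to the source block, (d) its tent, (e) CT-4d's unit-tent Cauchy letter of every pair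
`(k+2, k+1)` read in `‖·‖∞` — all at the rate `κ₀` (the minimum of the suppliers'; envelopes are monotone in the rate). -/
theorem exists_refine_letters (hLc : 2 ≤ Lc) :
    ∃ κ₀ C c θ Φ₀ cT θK : ℝ, 0 < κ₀ ∧ 0 ≤ C ∧ 0 ≤ c ∧ 0 ≤ θ ∧ θ < 1 ∧ 0 ≤ Φ₀ ∧ 0 ≤ cT ∧ 0 ≤ θK ∧ θK < 1 ∧
      (∀ (m k : ℕ) (μ : Fin (3 + 1)) (z : Site (3 + 1)) (l'' : Fin (3 + 1)) (w' : Site (3 + 1)),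
        |respStep (d := 3) (Lc ^ m) (Lc ^ (m + k + 1)) μ z l'' w'| ≤
          C * ((Lc : ℝ) ^ (5 * (k + 1)))⁻¹ * Real.exp (-(κ₀ * supNorm (quo (Lc ^ (k + 1)) w' - z)))) ∧
      (∀ (s k : ℕ) (μ : Fin (3 + 1)) (z : Site (3 + 1)) (l : Fin (3 + 1)) (w : Site (3 + 1)),
        |respStep (d := 3) (Lc ^ (s + 1)) (Lc ^ (s + k + 2)) μ z l w - respStep (d := 3) (Lc ^ s) (Lc ^ (s + k + 1)) μ z l w|
          ≤ c * θ ^ (s + k) * ((((Lc ^ (k + 1) : ℕ) : ℝ)) ^ (3 + 2))⁻¹ * Real.exp (-(κ₀ * supNorm (quo (Lc ^ (k + 1)) w - z)))) ∧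
      (∀ (k : ℕ) (μ : Fin (3 + 1)) (z : Site (3 + 1)) (κ : Fin (3 + 1)) (y : Site (3 + 1)),
        |wΦ (N := Lc ^ (k + 1)) κ μ (y - z)| ≤ Φ₀ * ((Lc : ℝ) ^ (8 * (k + 1)))⁻¹ * Real.exp (-(κ₀ * supNorm (y - z)))) ∧
      (∀ (k : ℕ) (μ : Fin (3 + 1)) (z : Site (3 + 1)) (κ : Fin (3 + 1)) (u : Site (3 + 1)),
        |contourSumAdj (Lc ^ (k + 1)) (fun κ y => wΦ (N := Lc ^ (k + 1)) κ μ (y - z)) κ u|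
          ≤ (Lc ^ (k + 1) : ℕ) * (Φ₀ * ((Lc : ℝ) ^ (8 * (k + 1)))⁻¹) * Real.exp κ₀ * Real.exp (-(κ₀ * supNorm (quo (Lc ^ (k + 1)) u - z)))) ∧
      (∀ (k : ℕ) (μt : Fin (3 + 1)) (zt : Site (3 + 1)) (κ' : Fin (3 + 1)) (y : Site (3 + 1)),
        |(((Lc : ℝ) ^ (k + 2)) ^ (2 * (3 + 1))) * wΦ (N := Lc ^ (k + 2)) κ' μt (y - zt)
            - (((Lc : ℝ) ^ (k + 1)) ^ (2 * (3 + 1))) * wΦ (N := Lc ^ (k + 1)) κ' μt (y - zt)| ≤ (cT * θK ^ k) * Real.exp (-(κ₀ * supNorm (y - zt)))) := by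
  obtain ⟨κ₁, C, -, hκ₁, hC, -, hN1, -⟩ := exists_respStep_decay_and_grad (Lc := Lc)
  obtain ⟨c, θ, κ₂, hc, hθ0, hθ1, hκ₂, hCau⟩ := exists_respStep_cauchy (Lc := Lc) hLc
  obtain ⟨κ₃, Φ, hκ₃, hΦ, hI1⟩ := exists_wΦ_decay (Lc := Lc)
  obtain ⟨-, δ, cK, θK, hδ, hθK0, hθK1, -, hKall⟩ := exists_unitTent_letters_three (Lc := Lc) hLc
  have hcK : 0 ≤ cK := by
    have h := hKall 0 0 0 0 0 0
    simp only [sub_self, abs_zero, pow_zero, mul_one] at h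
    exact le_of_mul_le_mul_right ((zero_mul _).le.trans_eq (by ring) |>.trans h) (Real.exp_pos _)
  set κ₀ : ℝ := min (min κ₁ κ₂) (min κ₃ δ) with hκ₀
  have h01 : κ₀ ≤ κ₁ := (min_le_left _ _).trans (min_le_left _ _)
  have h02 : κ₀ ≤ κ₂ := (min_le_left _ _).trans (min_le_right _ _)
  have h03 : κ₀ ≤ κ₃ := (min_le_right _ _).trans (min_le_left _ _)
  have h04 : κ₀ ≤ δ := (min_le_right _ _).trans (min_le_right _ _)
  have hκ₀pos : 0 < κ₀ := lt_min (lt_min hκ₁ hκ₂) (lt_min hκ₃ hδ)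
  have mono : ∀ {κ κ' : ℝ} (s : ℝ), κ ≤ κ' → 0 ≤ s → Real.exp (-(κ' * s)) ≤ Real.exp (-(κ * s)) :=
    fun s h hs => Real.exp_le_exp.2 (by nlinarith)
  have hΦenv : ∀ (k : ℕ) (μ : Fin (3 + 1)) (z : Site (3 + 1)) (κ : Fin (3 + 1)) (y : Site (3 + 1)),
      |wΦ (N := Lc ^ (k + 1)) κ μ (y - z)| ≤ Φ * ((Lc : ℝ) ^ (8 * (k + 1)))⁻¹ * Real.exp (-(κ₀ * supNorm (y - z))) := by
    intro k μ z κ y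
    have h := hI1 k κ μ (y - z)
    rw [inv_cast_pow_pow, inv_cast_pow_pow] at h
    calc |wΦ (N := Lc ^ (k + 1)) κ μ (y - z)|
        ≤ Φ * ((Lc : ℝ) ^ (5 * (k + 1)))⁻¹ * ((Lc : ℝ) ^ (3 * (k + 1)))⁻¹ * Real.exp (-(κ₃ * supNorm (y - z))) := h
      _ = Φ * ((Lc : ℝ) ^ (8 * (k + 1)))⁻¹ * Real.exp (-(κ₃ * supNorm (y - z))) := by
          rw [show 8 * (k + 1) = 5 * (k + 1) + 3 * (k + 1) by ring, pow_add, mul_inv]; ring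
      _ ≤ Φ * ((Lc : ℝ) ^ (8 * (k + 1)))⁻¹ * Real.exp (-(κ₀ * supNorm (y - z))) :=
          mul_le_mul_of_nonneg_left (mono _ h03 (supNorm_nonneg _)) (by positivity)
  refine ⟨κ₀, C, c, θ, Φ, cK, θK, hκ₀pos, hC, hc, hθ0, hθ1, hΦ, hcK, hθK0, hθK1,
    fun m k μ z l'' w' => ?_, fun s k μ z l w => ?_, hΦenv, fun k μ z κ u => ?_, fun k μt zt κ' y => ?_⟩
  · have h := hN1 m k μ z l'' w'
    rw [inv_cast_pow_pow] at h
    exact h.trans (mul_le_mul_of_nonneg_left (mono _ h01 (supNorm_nonneg _)) (by positivity))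
  · exact (hCau s k μ z l w).trans (mul_le_mul_of_nonneg_left (mono _ h02 (supNorm_nonneg _)) (by positivity))
  · haveI : NeZero (Lc ^ (k + 1)) := ⟨pow_ne_zero _ (NeZero.ne Lc)⟩
    have hNpos : 0 < Lc ^ (k + 1) := pow_pos (Nat.pos_of_ne_zero (NeZero.ne Lc)) _
    have h := abs_contourSumAdj_le (d := 3) hNpos (φ := fun κ' y => wΦ (N := Lc ^ (k + 1)) κ' μ (y + z - z))
      (B := Φ * ((Lc : ℝ) ^ (8 * (k + 1)))⁻¹) (κ₀ := κ₀) (by positivity) hκ₀pos.le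
      (fun κ' y => by have h' := hΦenv k μ z κ' (y + z); simp only [add_sub_cancel_right] at h' ⊢; exact h')
      κ (u - ((Lc ^ (k + 1) : ℕ) : ℤ) • z)
    rw [contourSumAdj_sub_zsmul, quo_sub_zsmul'] at h
    have e : (fun κ' y => (fun κ' y => wΦ (N := Lc ^ (k + 1)) κ' μ (y + z - z)) κ' (y - z))
        = fun κ' y => wΦ (N := Lc ^ (k + 1)) κ' μ (y - z) := by
      funext κ' y; simp only [sub_add_cancel]
    rw [e] at h
    exact h
  · have h := hKall k 1 κ' μt y zt
    rw [show k + 1 + 1 = k + 2 from rfl] at h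
    have henv : Real.exp (-δ * l1 (y - zt)) ≤ Real.exp (-(κ₀ * supNorm (y - zt))) := by
      rw [Real.exp_le_exp, neg_mul, neg_le_neg_iff]
      exact (mul_le_mul_of_nonneg_right h04 (supNorm_nonneg _)).trans (mul_le_mul_of_nonneg_left (supNorm_le_l1 _) hδ.le)
    exact h.trans (mul_le_mul_of_nonneg_left henv (by positivity))

/-! ## §2 The power count and the packaged END -/

/-- [folklore] **THE POWER COUNT**: multiplied by the table currency `Lc^{12(k+2)}` and the envelope counts `N′^4`, `N^4`, the three weight bounds of the parametric END are
`A₁·(k+2)(Lc^{k+1})⁻¹ + A₂·(Lc^{k+1})⁻¹ + A₃·θ^k + A₄·θK^k` EXACTLY with `k`-FREE `A_i` — every power of the level cancels (CT4-DESIGN §4 (iii): «a mismatch by a power of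
`Lc` per level would be fatal»; there is none). -/
theorem powerCount_eq {κ₀ C c θ Φ₀ cT θK : ℝ} (k : ℕ) :
    (Lc : ℝ) ^ (12 * (k + 2)) * ((((((k + 1 : ℕ) : ℝ)) + 1) * (2 * Real.exp (2 * κ₀) * (((Lc ^ (k + 2) : ℕ) : ℝ) * (Φ₀ * ((Lc : ℝ) ^ (8 * (k + 2)))⁻¹) * Real.exp κ₀) * (8 * (Lc : ℝ) * C * ((Lc : ℝ) ^ (5 * (k + 2)))⁻¹) * (8 * (Lc : ℝ) * C * ((Lc : ℝ) ^ (5 * (k + 2)))⁻¹))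
          + 8 * Real.exp (5 * κ₀) * (8 * (Lc : ℝ) * (c * θ ^ k) * ((Lc : ℝ) ^ (5 * (k + 2)))⁻¹) * (8 * (Lc : ℝ) * C * ((Lc : ℝ) ^ (5 * (k + 2)))⁻¹) * (Lc : ℝ) ^ (k + 1) * (2 * (((Lc ^ (k + 2) : ℕ) : ℝ) * (Φ₀ * ((Lc : ℝ) ^ (8 * (k + 2)))⁻¹) * Real.exp κ₀) + (Φ₀ * ((Lc : ℝ) ^ (8 * (k + 2)))⁻¹) * (Lc : ℝ) ^ (k + 1)))
        + (2 * Real.exp (5 * κ₀) * (8 * (Lc : ℝ) * C * ((Lc : ℝ) ^ (5 * (k + 2)))⁻¹) * (8 * (Lc : ℝ) * C * ((Lc : ℝ) ^ (5 * (k + 2)))⁻¹) * (((((k + 1 : ℕ) : ℝ)) + 1) * (((Lc ^ (k + 2) : ℕ) : ℝ) * (Φ₀ * ((Lc : ℝ) ^ (8 * (k + 2)))⁻¹) * Real.exp κ₀) + 2 * (Φ₀ * ((Lc : ℝ) ^ (8 * (k + 2)))⁻¹) * (Lc : ℝ) ^ (k + 1))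
          + 8 * Real.exp (5 * κ₀) * (8 * (Lc : ℝ) * C * ((Lc : ℝ) ^ (5 * (k + 2)))⁻¹) * (8 * (Lc : ℝ) * (c * θ ^ k) * ((Lc : ℝ) ^ (5 * (k + 2)))⁻¹) * (Lc : ℝ) ^ (k + 1) * (2 * (((Lc ^ (k + 2) : ℕ) : ℝ) * (Φ₀ * ((Lc : ℝ) ^ (8 * (k + 2)))⁻¹) * Real.exp κ₀) + (Φ₀ * ((Lc : ℝ) ^ (8 * (k + 2)))⁻¹) * (Lc : ℝ) ^ (k + 1)))) * ((((Lc ^ (k + 2) : ℕ) : ℝ)) ^ (3 + 1))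
      + (Lc : ℝ) ^ (12 * (k + 2)) * (8 * Real.exp (5 * κ₀) * (8 * (Lc : ℝ) * C * ((Lc : ℝ) ^ (5 * (k + 1)))⁻¹) * (8 * (Lc : ℝ) * C * ((Lc : ℝ) ^ (5 * (k + 1)))⁻¹) * (Lc : ℝ) ^ k * (2 * (((Lc ^ (k + 1) : ℕ) : ℝ) * ((cT * θK ^ k) * ((Lc : ℝ) ^ 4 * ((Lc : ℝ) ^ (k + 2)) ^ 8)⁻¹) * Real.exp κ₀) + ((cT * θK ^ k) * ((Lc : ℝ) ^ 4 * ((Lc : ℝ) ^ (k + 2)) ^ 8)⁻¹) * (Lc : ℝ) ^ k)) * ((((Lc ^ (k + 1) : ℕ) : ℝ)) ^ (3 + 1))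
    = (128 * (Real.exp (2 * κ₀) * Real.exp κ₀) * Φ₀ * (Lc : ℝ) * C * C + 128 * (Real.exp (5 * κ₀) * Real.exp κ₀) * (Lc : ℝ) * C * C * Φ₀) * (((((k + 1 : ℕ) : ℝ)) + 1) * (((Lc : ℝ) ^ (k + 1)))⁻¹)
      + (256 * Real.exp (5 * κ₀) * C * C * Φ₀) * (((Lc : ℝ) ^ (k + 1)))⁻¹
      + (1024 * Real.exp (5 * κ₀) * C * c * Φ₀ * (2 * Real.exp κ₀ * (Lc : ℝ) + 1)) * θ ^ k + (512 * Real.exp (5 * κ₀) * C * C * cT * (2 * Real.exp κ₀ * (Lc : ℝ) + 1)) * θK ^ k := by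
  have hL : (Lc : ℝ) ≠ 0 := by exact_mod_cast NeZero.ne Lc
  push_cast
  have e5 : (Lc : ℝ) ^ (5 * (k + 2)) = ((Lc : ℝ) ^ k) ^ 5 * (Lc : ℝ) ^ 10 := by rw [← pow_mul, ← pow_add]; ring_nf
  have e8 : (Lc : ℝ) ^ (8 * (k + 2)) = ((Lc : ℝ) ^ k) ^ 8 * (Lc : ℝ) ^ 16 := by rw [← pow_mul, ← pow_add]; ring_nf
  have e12 : (Lc : ℝ) ^ (12 * (k + 2)) = ((Lc : ℝ) ^ k) ^ 12 * (Lc : ℝ) ^ 24 := by rw [← pow_mul, ← pow_add]; ring_nf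
  have e51 : (Lc : ℝ) ^ (5 * (k + 1)) = ((Lc : ℝ) ^ k) ^ 5 * (Lc : ℝ) ^ 5 := by rw [← pow_mul, ← pow_add]; ring_nf
  have e2 : (Lc : ℝ) ^ (k + 2) = (Lc : ℝ) ^ k * (Lc : ℝ) ^ 2 := by rw [← pow_add]
  have e1 : (Lc : ℝ) ^ (k + 1) = (Lc : ℝ) ^ k * Lc := by rw [pow_succ]
  rw [e5, e8, e12, e51, e2, e1]
  have hM : (Lc : ℝ) ^ k ≠ 0 := pow_ne_zero _ hL
  field_simp
  ring

omit [NeZero Lc] in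
/-- [folklore] The bound of the power count: `(k+2)(Lc^{k+1})⁻¹ ≤ 2·ρ^k`, `(Lc^{k+1})⁻¹ ≤ 2·ρ^k` (`ρ = 3∕(2Lc)`), `θ^k, θK^k, ρ^k ≤ θP^k` ⟹ `≤ K₀·θP^k`. -/
theorem powerCount_le {κ₀ C c θ Φ₀ cT θK θP : ℝ} (hLc : 2 ≤ Lc) (hC : 0 ≤ C) (hc : 0 ≤ c) (hθ0 : 0 ≤ θ) (hΦ : 0 ≤ Φ₀) (hcT : 0 ≤ cT)
    (hθK0 : 0 ≤ θK) (hθle : θ ≤ θP) (hθKle : θK ≤ θP) (hρle : (3 : ℝ) / (2 * Lc) ≤ θP) (k : ℕ) :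
    (128 * (Real.exp (2 * κ₀) * Real.exp κ₀) * Φ₀ * (Lc : ℝ) * C * C + 128 * (Real.exp (5 * κ₀) * Real.exp κ₀) * (Lc : ℝ) * C * C * Φ₀) * (((((k + 1 : ℕ) : ℝ)) + 1) * (((Lc : ℝ) ^ (k + 1)))⁻¹)
      + (256 * Real.exp (5 * κ₀) * C * C * Φ₀) * (((Lc : ℝ) ^ (k + 1)))⁻¹
      + (1024 * Real.exp (5 * κ₀) * C * c * Φ₀ * (2 * Real.exp κ₀ * (Lc : ℝ) + 1)) * θ ^ k + (512 * Real.exp (5 * κ₀) * C * C * cT * (2 * Real.exp κ₀ * (Lc : ℝ) + 1)) * θK ^ k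
    ≤ (2 * (128 * (Real.exp (2 * κ₀) * Real.exp κ₀) * Φ₀ * (Lc : ℝ) * C * C + 128 * (Real.exp (5 * κ₀) * Real.exp κ₀) * (Lc : ℝ) * C * C * Φ₀) + 2 * (256 * Real.exp (5 * κ₀) * C * C * Φ₀) + (1024 * Real.exp (5 * κ₀) * C * c * Φ₀ * (2 * Real.exp κ₀ * (Lc : ℝ) + 1)) + (512 * Real.exp (5 * κ₀) * C * C * cT * (2 * Real.exp κ₀ * (Lc : ℝ) + 1))) * θP ^ k := by
  obtain ⟨hρ0, hρ1⟩ := three_div_two_mul_lt_one hLc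
  have hL0 : (0 : ℝ) < (Lc : ℝ) := by exact_mod_cast (show 0 < Lc by omega)
  have hq : ((((k + 1 : ℕ) : ℝ)) + 1) * (((Lc : ℝ) ^ (k + 1)))⁻¹ ≤ 2 * ((3 : ℝ) / (2 * Lc)) ^ k := by
    have h := succ_mul_inv_pow_le (Lc := Lc) (by omega) (k + 1)
    push_cast at h ⊢
    refine h.trans ?_
    rw [pow_succ]
    nlinarith [pow_nonneg hρ0 k]
  have hr : (((Lc : ℝ) ^ (k + 1)))⁻¹ ≤ 2 * ((3 : ℝ) / (2 * Lc)) ^ k := by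
    refine le_trans ?_ hq
    have h1 : (1 : ℝ) ≤ ((((k + 1 : ℕ) : ℝ)) + 1) := by push_cast; linarith [(Nat.cast_nonneg k : (0:ℝ) ≤ k)]
    have h0 : 0 ≤ (((Lc : ℝ) ^ (k + 1)))⁻¹ := by positivity
    nlinarith
  have hθk : θ ^ k ≤ θP ^ k := pow_le_pow_left₀ hθ0 hθle k
  have hθKk : θK ^ k ≤ θP ^ k := pow_le_pow_left₀ hθK0 hθKle k
  have hρk : ((3 : ℝ) / (2 * Lc)) ^ k ≤ θP ^ k := pow_le_pow_left₀ hρ0 hρle k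
  have hA1 : 0 ≤ (128 * (Real.exp (2 * κ₀) * Real.exp κ₀) * Φ₀ * (Lc : ℝ) * C * C + 128 * (Real.exp (5 * κ₀) * Real.exp κ₀) * (Lc : ℝ) * C * C * Φ₀) := by positivity
  have hA2 : 0 ≤ (256 * Real.exp (5 * κ₀) * C * C * Φ₀) := by positivity
  have hA3 : 0 ≤ (1024 * Real.exp (5 * κ₀) * C * c * Φ₀ * (2 * Real.exp κ₀ * (Lc : ℝ) + 1)) := by positivity
  have hA4 : 0 ≤ (512 * Real.exp (5 * κ₀) * C * C * cT * (2 * Real.exp κ₀ * (Lc : ℝ) + 1)) := by positivity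
  have t1 := mul_le_mul_of_nonneg_left (hq.trans (mul_le_mul_of_nonneg_left hρk (by norm_num))) hA1
  have t2 := mul_le_mul_of_nonneg_left (hr.trans (mul_le_mul_of_nonneg_left hρk (by norm_num))) hA2
  have t3 := mul_le_mul_of_nonneg_left hθk hA3
  have t4 := mul_le_mul_of_nonneg_left hθKk hA4
  linarith [t1, t2, t3, t4]

/-- NOT IN PRINT; OUR BOOKKEEPING.  **CT-4c SHAPE P at `d = 3`, PACKAGED — THE P-ATOM OF THE CELLS, DIFFERENCED ACROSS TWO CONSECUTIVE TOWERS, IS `θP^k`-SMALL IN TABLE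
UNITS** (every `Lc ≥ 2`, NO hypothesis beyond it): ONE rate `κ₀ > 0`, ONE constant `K ≥ 0` and ONE `θP ∈ [0,1)` (`= max(θ_{CT-4a}, θ_K, 3∕(2Lc))`) such that for every in-block root
`rr`, every `k`, every tent source `(μt, zt)`, read-gauge source `(μ₁, z₁)`, jumping-gauge source `(μ₂, z₂)`, every bond reading `|θ₀| + |θ₁| ≤ 1` and every direction `κ`,
`|Lc^{12(k+2)}·Σ'_v 𝒬ᵀ_{Lc^(k+2)}[wΦ_{Lc^(k+2)}(·;μt;·−zt)] κ v·(θ₀λ′₁ v + θ₁λ′₁(v+e_κ))·(λ′₂(v+e_κ) − λ′₂ v) − Lc^{12(k+1)}·Σ'_w 𝒬ᵀ_{Lc^(k+1)}[wΦ_{Lc^(k+1)}(·;μt;·−zt)] κ w·(θ₀λ₁ w + θ₁λ₁(w+e_κ))·(λ₂(w+e_κ) − λ₂ w)|`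
`≤ K·θP^k·e^{−(κ₀∕12)(‖z₁ − zt‖∞ + ‖z₂ − zt‖∞)}` (`λ′_i`, `λ_i` as in `ContactRefinePThree`). -/
theorem exists_pairingAtom_refine_three (hLc : 2 ≤ Lc) :
    ∃ κ₀ K θP : ℝ, 0 < κ₀ ∧ 0 ≤ K ∧ 0 ≤ θP ∧ θP < 1 ∧
      ∀ (rr : Fin (3 + 1) → ℕ), rr ∈ box (3 + 1) Lc →
        ∀ (k : ℕ) (μt : Fin (3 + 1)) (zt : Site (3 + 1)) (μ₁ : Fin (3 + 1)) (z₁ : Site (3 + 1)) (μ₂ : Fin (3 + 1)) (z₂ : Site (3 + 1))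
          (θ₀ θ₁ : ℝ), |θ₀| + |θ₁| ≤ 1 → ∀ (κ : Fin (3 + 1)),
          |(Lc : ℝ) ^ (12 * (k + 2)) * (∑' v : Site (3 + 1), contourSumAdj (Lc ^ (k + 2)) (fun κ' y => wΦ (N := Lc ^ (k + 2)) κ' μt (y - zt)) κ v
            * (θ₀ * (Psi (toSite rr) Lc 0 (k + 1) (delta1 μ₁ z₁) v - bmGaugeAt (toSite rr) (respStep (d := 3) 1 (Lc ^ (k + 2)) μ₁ z₁) Lc v)
              + θ₁ * (Psi (toSite rr) Lc 0 (k + 1) (delta1 μ₁ z₁) (v + unitVec κ) - bmGaugeAt (toSite rr) (respStep (d := 3) 1 (Lc ^ (k + 2)) μ₁ z₁) Lc (v + unitVec κ)))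
            * ((Psi (toSite rr) Lc 0 (k + 1) (delta1 μ₂ z₂) (v + unitVec κ) - bmGaugeAt (toSite rr) (respStep (d := 3) 1 (Lc ^ (k + 2)) μ₂ z₂) Lc (v + unitVec κ))
              - (Psi (toSite rr) Lc 0 (k + 1) (delta1 μ₂ z₂) v - bmGaugeAt (toSite rr) (respStep (d := 3) 1 (Lc ^ (k + 2)) μ₂ z₂) Lc v)))
            - (Lc : ℝ) ^ (12 * (k + 1)) * (∑' w : Site (3 + 1), contourSumAdj (Lc ^ (k + 1)) (fun κ' y => wΦ (N := Lc ^ (k + 1)) κ' μt (y - zt)) κ w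
            * (θ₀ * (Psi (toSite rr) Lc 0 k (delta1 μ₁ z₁) w - bmGaugeAt (toSite rr) (respStep (d := 3) 1 (Lc ^ (k + 1)) μ₁ z₁) Lc w)
              + θ₁ * (Psi (toSite rr) Lc 0 k (delta1 μ₁ z₁) (w + unitVec κ) - bmGaugeAt (toSite rr) (respStep (d := 3) 1 (Lc ^ (k + 1)) μ₁ z₁) Lc (w + unitVec κ)))
            * ((Psi (toSite rr) Lc 0 k (delta1 μ₂ z₂) (w + unitVec κ) - bmGaugeAt (toSite rr) (respStep (d := 3) 1 (Lc ^ (k + 1)) μ₂ z₂) Lc (w + unitVec κ))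
              - (Psi (toSite rr) Lc 0 k (delta1 μ₂ z₂) w - bmGaugeAt (toSite rr) (respStep (d := 3) 1 (Lc ^ (k + 1)) μ₂ z₂) Lc w)))|
            ≤ K * θP ^ k * Real.exp (-(κ₀ / 12) * (supNorm (z₁ - zt) + supNorm (z₂ - zt))) := by
  obtain ⟨κ₀, C, c, θ, Φ₀, cT, θK, hκ, hC, hc, hθ0, hθ1, hΦ, hcT, hθK0, hθK1, hN1, hCau, hΦenv, ht, hTd⟩ := exists_refine_letters (Lc := Lc) hLc
  obtain ⟨hρ0, hρ1⟩ := three_div_two_mul_lt_one hLc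
  have hL0 : (0 : ℝ) < (Lc : ℝ) := by exact_mod_cast (show 0 < Lc by omega)
  have hθP0 : 0 ≤ max θ (max θK ((3 : ℝ) / (2 * Lc))) := hθ0.trans (le_max_left _ _)
  have hθP1 : max θ (max θK ((3 : ℝ) / (2 * Lc))) < 1 := max_lt hθ1 (max_lt hθK1 hρ1)
  have hθle : θ ≤ max θ (max θK ((3 : ℝ) / (2 * Lc))) := le_max_left _ _
  have hθKle : θK ≤ max θ (max θK ((3 : ℝ) / (2 * Lc))) := (le_max_left _ _).trans (le_max_right _ _)
  have hρle : (3 : ℝ) / (2 * Lc) ≤ max θ (max θK ((3 : ℝ) / (2 * Lc))) := (le_max_right _ _).trans (le_max_right _ _)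
  have hZ0 : 0 ≤ Zl (3 + 1) (κ₀ / (4 * (((3 : ℕ) : ℝ) + 1))) := Zl_nonneg (by positivity)
  have hK₀0 : 0 ≤ (2 * (128 * (Real.exp (2 * κ₀) * Real.exp κ₀) * Φ₀ * (Lc : ℝ) * C * C + 128 * (Real.exp (5 * κ₀) * Real.exp κ₀) * (Lc : ℝ) * C * C * Φ₀) + 2 * (256 * Real.exp (5 * κ₀) * C * C * Φ₀) + (1024 * Real.exp (5 * κ₀) * C * c * Φ₀ * (2 * Real.exp κ₀ * (Lc : ℝ) + 1)) + (512 * Real.exp (5 * κ₀) * C * C * cT * (2 * Real.exp κ₀ * (Lc : ℝ) + 1))) := by positivity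
  refine ⟨κ₀, (2 * (128 * (Real.exp (2 * κ₀) * Real.exp κ₀) * Φ₀ * (Lc : ℝ) * C * C + 128 * (Real.exp (5 * κ₀) * Real.exp κ₀) * (Lc : ℝ) * C * C * Φ₀) + 2 * (256 * Real.exp (5 * κ₀) * C * C * Φ₀) + (1024 * Real.exp (5 * κ₀) * C * c * Φ₀ * (2 * Real.exp κ₀ * (Lc : ℝ) + 1)) + (512 * Real.exp (5 * κ₀) * C * C * cT * (2 * Real.exp κ₀ * (Lc : ℝ) + 1))) * Zl (3 + 1) (κ₀ / (4 * (((3 : ℕ) : ℝ) + 1))), max θ (max θK ((3 : ℝ) / (2 * Lc))), hκ, by positivity, hθP0, hθP1,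
    fun rr hrr k μt zt μ₁ z₁ μ₂ z₂ θ₀ θ₁ hθr κ => ?_⟩
  have hN1' : 1 ≤ Lc ^ (k + 1) := Nat.one_le_pow _ _ (by omega)
  have hN2' : 1 ≤ Lc ^ (k + 2) := Nat.one_le_pow _ _ (by omega)
  have hA := abs_pairingAtom_refine_le (Lc := Lc) hLc hrr hκ hC hc hθ0 hΦ hN1 hCau hΦenv ht k μt zt (hTd k μt zt) μ₁ z₁ μ₂ z₂ hθr κ
  -- table units
  have e12 : (Lc : ℝ) ^ (12 * (k + 1)) = (Lc : ℝ) ^ (12 * (k + 2)) * ((Lc : ℝ) ^ 12)⁻¹ := by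
    rw [show 12 * (k + 2) = 12 * (k + 1) + 12 by ring, pow_add, mul_assoc, mul_inv_cancel₀ (pow_ne_zero _ hL0.ne'), mul_one]
  have h12 : (0 : ℝ) < (Lc : ℝ) ^ (12 * (k + 2)) := pow_pos hL0 _
  rw [e12, mul_assoc, ← mul_sub, abs_mul, abs_of_pos h12]
  refine (mul_le_mul_of_nonneg_left hA h12.le).trans ?_
  -- the two envelope series
  obtain ⟨-, hS'⟩ := tsum_env3_le (d := 3) (L := Lc ^ (k + 2)) hN2' hκ zt z₁ z₂
  obtain ⟨-, hS⟩ := tsum_env3_le (d := 3) (L := Lc ^ (k + 1)) hN1' hκ zt z₁ z₂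
  have hB12 : 0 ≤ (((((k + 1 : ℕ) : ℝ)) + 1) * (2 * Real.exp (2 * κ₀) * (((Lc ^ (k + 2) : ℕ) : ℝ) * (Φ₀ * ((Lc : ℝ) ^ (8 * (k + 2)))⁻¹) * Real.exp κ₀) * (8 * (Lc : ℝ) * C * ((Lc : ℝ) ^ (5 * (k + 2)))⁻¹) * (8 * (Lc : ℝ) * C * ((Lc : ℝ) ^ (5 * (k + 2)))⁻¹))
          + 8 * Real.exp (5 * κ₀) * (8 * (Lc : ℝ) * (c * θ ^ k) * ((Lc : ℝ) ^ (5 * (k + 2)))⁻¹) * (8 * (Lc : ℝ) * C * ((Lc : ℝ) ^ (5 * (k + 2)))⁻¹) * (Lc : ℝ) ^ (k + 1) * (2 * (((Lc ^ (k + 2) : ℕ) : ℝ) * (Φ₀ * ((Lc : ℝ) ^ (8 * (k + 2)))⁻¹) * Real.exp κ₀) + (Φ₀ * ((Lc : ℝ) ^ (8 * (k + 2)))⁻¹) * (Lc : ℝ) ^ (k + 1)))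
        + (2 * Real.exp (5 * κ₀) * (8 * (Lc : ℝ) * C * ((Lc : ℝ) ^ (5 * (k + 2)))⁻¹) * (8 * (Lc : ℝ) * C * ((Lc : ℝ) ^ (5 * (k + 2)))⁻¹) * (((((k + 1 : ℕ) : ℝ)) + 1) * (((Lc ^ (k + 2) : ℕ) : ℝ) * (Φ₀ * ((Lc : ℝ) ^ (8 * (k + 2)))⁻¹) * Real.exp κ₀) + 2 * (Φ₀ * ((Lc : ℝ) ^ (8 * (k + 2)))⁻¹) * (Lc : ℝ) ^ (k + 1))
          + 8 * Real.exp (5 * κ₀) * (8 * (Lc : ℝ) * C * ((Lc : ℝ) ^ (5 * (k + 2)))⁻¹) * (8 * (Lc : ℝ) * (c * θ ^ k) * ((Lc : ℝ) ^ (5 * (k + 2)))⁻¹) * (Lc : ℝ) ^ (k + 1) * (2 * (((Lc ^ (k + 2) : ℕ) : ℝ) * (Φ₀ * ((Lc : ℝ) ^ (8 * (k + 2)))⁻¹) * Real.exp κ₀) + (Φ₀ * ((Lc : ℝ) ^ (8 * (k + 2)))⁻¹) * (Lc : ℝ) ^ (k + 1))) := by positivity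
  have hB3 : 0 ≤ (8 * Real.exp (5 * κ₀) * (8 * (Lc : ℝ) * C * ((Lc : ℝ) ^ (5 * (k + 1)))⁻¹) * (8 * (Lc : ℝ) * C * ((Lc : ℝ) ^ (5 * (k + 1)))⁻¹) * (Lc : ℝ) ^ k * (2 * (((Lc ^ (k + 1) : ℕ) : ℝ) * ((cT * θK ^ k) * ((Lc : ℝ) ^ 4 * ((Lc : ℝ) ^ (k + 2)) ^ 8)⁻¹) * Real.exp κ₀) + ((cT * θK ^ k) * ((Lc : ℝ) ^ 4 * ((Lc : ℝ) ^ (k + 2)) ^ 8)⁻¹) * (Lc : ℝ) ^ k)) := by positivity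
  have hstep := add_le_add (mul_le_mul_of_nonneg_left hS' hB12) (mul_le_mul_of_nonneg_left hS hB3)
  refine (mul_le_mul_of_nonneg_left hstep h12.le).trans ?_
  -- the power count
  have hcount := (powerCount_eq (Lc := Lc) (κ₀ := κ₀) (C := C) (c := c) (θ := θ) (Φ₀ := Φ₀) (cT := cT) (θK := θK) k).trans_le
    (powerCount_le (Lc := Lc) hLc hC hc hθ0 hΦ hcT hθK0 hθle hθKle hρle k)
  have hE0 : 0 ≤ Real.exp (-(κ₀ / 12) * (supNorm (z₁ - zt) + supNorm (z₂ - zt))) := (Real.exp_pos _).le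
  calc (Lc : ℝ) ^ (12 * (k + 2)) * (((((((k + 1 : ℕ) : ℝ)) + 1) * (2 * Real.exp (2 * κ₀) * (((Lc ^ (k + 2) : ℕ) : ℝ) * (Φ₀ * ((Lc : ℝ) ^ (8 * (k + 2)))⁻¹) * Real.exp κ₀) * (8 * (Lc : ℝ) * C * ((Lc : ℝ) ^ (5 * (k + 2)))⁻¹) * (8 * (Lc : ℝ) * C * ((Lc : ℝ) ^ (5 * (k + 2)))⁻¹))
          + 8 * Real.exp (5 * κ₀) * (8 * (Lc : ℝ) * (c * θ ^ k) * ((Lc : ℝ) ^ (5 * (k + 2)))⁻¹) * (8 * (Lc : ℝ) * C * ((Lc : ℝ) ^ (5 * (k + 2)))⁻¹) * (Lc : ℝ) ^ (k + 1) * (2 * (((Lc ^ (k + 2) : ℕ) : ℝ) * (Φ₀ * ((Lc : ℝ) ^ (8 * (k + 2)))⁻¹) * Real.exp κ₀) + (Φ₀ * ((Lc : ℝ) ^ (8 * (k + 2)))⁻¹) * (Lc : ℝ) ^ (k + 1)))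
        + (2 * Real.exp (5 * κ₀) * (8 * (Lc : ℝ) * C * ((Lc : ℝ) ^ (5 * (k + 2)))⁻¹) * (8 * (Lc : ℝ) * C * ((Lc : ℝ) ^ (5 * (k + 2)))⁻¹) * (((((k + 1 : ℕ) : ℝ)) + 1) * (((Lc ^ (k + 2) : ℕ) : ℝ) * (Φ₀ * ((Lc : ℝ) ^ (8 * (k + 2)))⁻¹) * Real.exp κ₀) + 2 * (Φ₀ * ((Lc : ℝ) ^ (8 * (k + 2)))⁻¹) * (Lc : ℝ) ^ (k + 1))
          + 8 * Real.exp (5 * κ₀) * (8 * (Lc : ℝ) * C * ((Lc : ℝ) ^ (5 * (k + 2)))⁻¹) * (8 * (Lc : ℝ) * (c * θ ^ k) * ((Lc : ℝ) ^ (5 * (k + 2)))⁻¹) * (Lc : ℝ) ^ (k + 1) * (2 * (((Lc ^ (k + 2) : ℕ) : ℝ) * (Φ₀ * ((Lc : ℝ) ^ (8 * (k + 2)))⁻¹) * Real.exp κ₀) + (Φ₀ * ((Lc : ℝ) ^ (8 * (k + 2)))⁻¹) * (Lc : ℝ) ^ (k + 1)))) * (((((Lc ^ (k + 2) : ℕ)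 : ℝ)) ^ (3 + 1)) * Zl (3 + 1) (κ₀ / (4 * (((3 : ℕ) : ℝ) + 1))) * Real.exp (-(κ₀ / 12) * (supNorm (z₁ - zt) + supNorm (z₂ - zt))))
          + (8 * Real.exp (5 * κ₀) * (8 * (Lc : ℝ) * C * ((Lc : ℝ) ^ (5 * (k + 1)))⁻¹) * (8 * (Lc : ℝ) * C * ((Lc : ℝ) ^ (5 * (k + 1)))⁻¹) * (Lc : ℝ) ^ k * (2 * (((Lc ^ (k + 1) : ℕ) : ℝ) * ((cT * θK ^ k) * ((Lc : ℝ) ^ 4 * ((Lc : ℝ) ^ (k + 2)) ^ 8)⁻¹) * Real.exp κ₀) + ((cT * θK ^ k) * ((Lc : ℝ) ^ 4 * ((Lc : ℝ) ^ (k + 2)) ^ 8)⁻¹) * (Lc : ℝ) ^ k)) * (((((Lc ^ (k + 1) : ℕ) : ℝ)) ^ (3 + 1)) * Zl (3 + 1) (κ₀ / (4 * (((3 : ℕ) : ℝ) + 1))) * Real.exp (-(κ₀ / 12) * (supNorm (z₁ - zt) + supNorm (z₂ - zt)))))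
      = ((Lc : ℝ) ^ (12 * (k + 2)) * ((((((k + 1 : ℕ) : ℝ)) + 1) * (2 * Real.exp (2 * κ₀) * (((Lc ^ (k + 2) : ℕ) : ℝ) * (Φ₀ * ((Lc : ℝ) ^ (8 * (k + 2)))⁻¹) * Real.exp κ₀) * (8 * (Lc : ℝ) * C * ((Lc : ℝ) ^ (5 * (k + 2)))⁻¹) * (8 * (Lc : ℝ) * C * ((Lc : ℝ) ^ (5 * (k + 2)))⁻¹))
          + 8 * Real.exp (5 * κ₀) * (8 * (Lc : ℝ) * (c * θ ^ k) * ((Lc : ℝ) ^ (5 * (k + 2)))⁻¹) * (8 * (Lc : ℝ) * C * ((Lc : ℝ) ^ (5 * (k + 2)))⁻¹) * (Lc : ℝ) ^ (k + 1) * (2 * (((Lc ^ (k + 2) : ℕ) : ℝ) * (Φ₀ * ((Lc : ℝ) ^ (8 * (k + 2)))⁻¹) * Real.exp κ₀) + (Φ₀ * ((Lc : ℝ) ^ (8 * (k + 2)))⁻¹) * (Lc : ℝ) ^ (k + 1)))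
        + (2 * Real.exp (5 * κ₀) * (8 * (Lc : ℝ) * C * ((Lc : ℝ) ^ (5 * (k + 2)))⁻¹) * (8 * (Lc : ℝ) * C * ((Lc : ℝ) ^ (5 * (k + 2)))⁻¹) * (((((k + 1 : ℕ) : ℝ)) + 1) * (((Lc ^ (k + 2) : ℕ) : ℝ) * (Φ₀ * ((Lc : ℝ) ^ (8 * (k + 2)))⁻¹) * Real.exp κ₀) + 2 * (Φ₀ * ((Lc : ℝ) ^ (8 * (k + 2)))⁻¹) * (Lc : ℝ) ^ (k + 1))
          + 8 * Real.exp (5 * κ₀) * (8 * (Lc : ℝ) * C * ((Lc : ℝ) ^ (5 * (k + 2)))⁻¹) * (8 * (Lc : ℝ) * (c * θ ^ k) * ((Lc : ℝ) ^ (5 * (k + 2)))⁻¹) * (Lc : ℝ) ^ (k + 1) * (2 * (((Lc ^ (k + 2) : ℕ) : ℝ) * (Φ₀ * ((Lc : ℝ) ^ (8 * (k + 2)))⁻¹) * Real.exp κ₀) + (Φ₀ * ((Lc : ℝ) ^ (8 * (k + 2)))⁻¹) * (Lc : ℝ) ^ (k + 1)))) * ((((Lc ^ (k + 2) : ℕ)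 : ℝ)) ^ (3 + 1))
      + (Lc : ℝ) ^ (12 * (k + 2)) * (8 * Real.exp (5 * κ₀) * (8 * (Lc : ℝ) * C * ((Lc : ℝ) ^ (5 * (k + 1)))⁻¹) * (8 * (Lc : ℝ) * C * ((Lc : ℝ) ^ (5 * (k + 1)))⁻¹) * (Lc : ℝ) ^ k * (2 * (((Lc ^ (k + 1) : ℕ) : ℝ) * ((cT * θK ^ k) * ((Lc : ℝ) ^ 4 * ((Lc : ℝ) ^ (k + 2)) ^ 8)⁻¹) * Real.exp κ₀) + ((cT * θK ^ k) * ((Lc : ℝ) ^ 4 * ((Lc : ℝ) ^ (k + 2)) ^ 8)⁻¹) * (Lc : ℝ) ^ k)) * ((((Lc ^ (k + 1) : ℕ) : ℝ)) ^ (3 + 1))) * (Zl (3 + 1) (κ₀ / (4 * (((3 : ℕ) : ℝ) + 1))) * Real.exp (-(κ₀ / 12) * (supNorm (z₁ - zt) + supNorm (z₂ - zt)))) := by ring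
    _ ≤ ((2 * (128 * (Real.exp (2 * κ₀) * Real.exp κ₀) * Φ₀ * (Lc : ℝ) * C * C + 128 * (Real.exp (5 * κ₀) * Real.exp κ₀) * (Lc : ℝ) * C * C * Φ₀) + 2 * (256 * Real.exp (5 * κ₀) * C * C * Φ₀) + (1024 * Real.exp (5 * κ₀) * C * c * Φ₀ * (2 * Real.exp κ₀ * (Lc : ℝ) + 1)) + (512 * Real.exp (5 * κ₀) * C * C * cT * (2 * Real.exp κ₀ * (Lc : ℝ) + 1))) * max θ (max θK ((3 : ℝ) / (2 * Lc))) ^ k) * (Zl (3 + 1) (κ₀ / (4 * (((3 : ℕ) : ℝ) + 1))) * Real.exp (-(κ₀ / 12) * (supNorm (z₁ - zt) + supNorm (z₂ - zt)))) := mul_le_mul_of_nonneg_right hcount (mul_nonneg hZ0 hE0)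
    _ = (2 * (128 * (Real.exp (2 * κ₀) * Real.exp κ₀) * Φ₀ * (Lc : ℝ) * C * C + 128 * (Real.exp (5 * κ₀) * Real.exp κ₀) * (Lc : ℝ) * C * C * Φ₀) + 2 * (256 * Real.exp (5 * κ₀) * C * C * Φ₀) + (1024 * Real.exp (5 * κ₀) * C * c * Φ₀ * (2 * Real.exp κ₀ * (Lc : ℝ) + 1)) + (512 * Real.exp (5 * κ₀) * C * C * cT * (2 * Real.exp κ₀ * (Lc : ℝ) + 1))) * Zl (3 + 1) (κ₀ / (4 * (((3 : ℕ) : ℝ) + 1))) * max θ (max θK ((3 : ℝ) / (2 * Lc))) ^ k * Real.exp (-(κ₀ / 12) * (supNorm (z₁ - zt) + supNorm (z₂ - zt))) := by ring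

/-- NOT IN PRINT; OUR BOOKKEEPING.  **THE TIP READING** (`θ = (0,1)`: the dressed-partner slot of leaf-02's `cell_eq′` after `ContactCellSplit.split_tip`) — `exists_pairingAtom_refine_three` with the summands rewritten by `ring`. -/
theorem exists_pairingAtomTip_refine_three (hLc : 2 ≤ Lc) :
    ∃ κ₀ K θP : ℝ, 0 < κ₀ ∧ 0 ≤ K ∧ 0 ≤ θP ∧ θP < 1 ∧
      ∀ (rr : Fin (3 + 1) → ℕ), rr ∈ box (3 + 1) Lc →
        ∀ (k : ℕ) (μt : Fin (3 + 1)) (zt : Site (3 + 1)) (μ₁ : Fin (3 + 1)) (z₁ : Site (3 + 1)) (μ₂ : Fin (3 + 1)) (z₂ : Site (3 + 1))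
          (κ : Fin (3 + 1)),
          |(Lc : ℝ) ^ (12 * (k + 2)) * (∑' v : Site (3 + 1), contourSumAdj (Lc ^ (k + 2)) (fun κ' y => wΦ (N := Lc ^ (k + 2)) κ' μt (y - zt)) κ v
            * (Psi (toSite rr) Lc 0 (k + 1) (delta1 μ₁ z₁) (v + unitVec κ) - bmGaugeAt (toSite rr) (respStep (d := 3) 1 (Lc ^ (k + 2)) μ₁ z₁) Lc (v + unitVec κ))
            * ((Psi (toSite rr) Lc 0 (k + 1) (delta1 μ₂ z₂) (v + unitVec κ) - bmGaugeAt (toSite rr) (respStep (d := 3) 1 (Lc ^ (k + 2)) μ₂ z₂) Lc (v + unitVec κ))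
              - (Psi (toSite rr) Lc 0 (k + 1) (delta1 μ₂ z₂) v - bmGaugeAt (toSite rr) (respStep (d := 3) 1 (Lc ^ (k + 2)) μ₂ z₂) Lc v)))
            - (Lc : ℝ) ^ (12 * (k + 1)) * (∑' w : Site (3 + 1), contourSumAdj (Lc ^ (k + 1)) (fun κ' y => wΦ (N := Lc ^ (k + 1)) κ' μt (y - zt)) κ w
            * (Psi (toSite rr) Lc 0 k (delta1 μ₁ z₁) (w + unitVec κ) - bmGaugeAt (toSite rr) (respStep (d := 3) 1 (Lc ^ (k + 1)) μ₁ z₁) Lc (w + unitVec κ))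
            * ((Psi (toSite rr) Lc 0 k (delta1 μ₂ z₂) (w + unitVec κ) - bmGaugeAt (toSite rr) (respStep (d := 3) 1 (Lc ^ (k + 1)) μ₂ z₂) Lc (w + unitVec κ))
              - (Psi (toSite rr) Lc 0 k (delta1 μ₂ z₂) w - bmGaugeAt (toSite rr) (respStep (d := 3) 1 (Lc ^ (k + 1)) μ₂ z₂) Lc w)))|
            ≤ K * θP ^ k * Real.exp (-(κ₀ / 12) * (supNorm (z₁ - zt) + supNorm (z₂ - zt))) := by
  obtain ⟨κ₀, K, θP, hκ, hK, hθP0, hθP1, h⟩ := exists_pairingAtom_refine_three (Lc := Lc) hLc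
  refine ⟨κ₀, K, θP, hκ, hK, hθP0, hθP1, fun rr hrr k μt zt μ₁ z₁ μ₂ z₂ κ => ?_⟩
  have hθr : |(0 : ℝ)| + |(1 : ℝ)| ≤ 1 := by norm_num
  have h' := h rr hrr k μt zt μ₁ z₁ μ₂ z₂ 0 1 hθr κ
  have e1 : (∑' v : Site (3 + 1), contourSumAdj (Lc ^ (k + 2)) (fun κ' y => wΦ (N := Lc ^ (k + 2)) κ' μt (y - zt)) κ v
            * (0 * (Psi (toSite rr) Lc 0 (k + 1) (delta1 μ₁ z₁) v - bmGaugeAt (toSite rr) (respStep (d := 3) 1 (Lc ^ (k + 2)) μ₁ z₁) Lc v)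
              + 1 * (Psi (toSite rr) Lc 0 (k + 1) (delta1 μ₁ z₁) (v + unitVec κ) - bmGaugeAt (toSite rr) (respStep (d := 3) 1 (Lc ^ (k + 2)) μ₁ z₁) Lc (v + unitVec κ)))
            * ((Psi (toSite rr) Lc 0 (k + 1) (delta1 μ₂ z₂) (v + unitVec κ) - bmGaugeAt (toSite rr) (respStep (d := 3) 1 (Lc ^ (k + 2)) μ₂ z₂) Lc (v + unitVec κ))
              - (Psi (toSite rr) Lc 0 (k + 1) (delta1 μ₂ z₂) v - bmGaugeAt (toSite rr) (respStep (d := 3) 1 (Lc ^ (k + 2)) μ₂ z₂) Lc v)))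
      = ∑' v : Site (3 + 1), contourSumAdj (Lc ^ (k + 2)) (fun κ' y => wΦ (N := Lc ^ (k + 2)) κ' μt (y - zt)) κ v
            * (Psi (toSite rr) Lc 0 (k + 1) (delta1 μ₁ z₁) (v + unitVec κ) - bmGaugeAt (toSite rr) (respStep (d := 3) 1 (Lc ^ (k + 2)) μ₁ z₁) Lc (v + unitVec κ))
            * ((Psi (toSite rr) Lc 0 (k + 1) (delta1 μ₂ z₂) (v + unitVec κ) - bmGaugeAt (toSite rr) (respStep (d := 3) 1 (Lc ^ (k + 2)) μ₂ z₂) Lc (v + unitVec κ))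
              - (Psi (toSite rr) Lc 0 (k + 1) (delta1 μ₂ z₂) v - bmGaugeAt (toSite rr) (respStep (d := 3) 1 (Lc ^ (k + 2)) μ₂ z₂) Lc v)) := tsum_congr fun v => by ring
  have e0 : (∑' w : Site (3 + 1), contourSumAdj (Lc ^ (k + 1)) (fun κ' y => wΦ (N := Lc ^ (k + 1)) κ' μt (y - zt)) κ w
            * (0 * (Psi (toSite rr) Lc 0 k (delta1 μ₁ z₁) w - bmGaugeAt (toSite rr) (respStep (d := 3) 1 (Lc ^ (k + 1)) μ₁ z₁) Lc w)
              + 1 * (Psi (toSite rr) Lc 0 k (delta1 μ₁ z₁) (w + unitVec κ) - bmGaugeAt (toSite rr) (respStep (d := 3) 1 (Lc ^ (k + 1)) μ₁ z₁) Lc (w + unitVec κ)))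
            * ((Psi (toSite rr) Lc 0 k (delta1 μ₂ z₂) (w + unitVec κ) - bmGaugeAt (toSite rr) (respStep (d := 3) 1 (Lc ^ (k + 1)) μ₂ z₂) Lc (w + unitVec κ))
              - (Psi (toSite rr) Lc 0 k (delta1 μ₂ z₂) w - bmGaugeAt (toSite rr) (respStep (d := 3) 1 (Lc ^ (k + 1)) μ₂ z₂) Lc w)))
      = ∑' w : Site (3 + 1), contourSumAdj (Lc ^ (k + 1)) (fun κ' y => wΦ (N := Lc ^ (k + 1)) κ' μt (y - zt)) κ w
            * (Psi (toSite rr) Lc 0 k (delta1 μ₁ z₁) (w + unitVec κ) - bmGaugeAt (toSite rr) (respStep (d := 3) 1 (Lc ^ (k + 1)) μ₁ z₁) Lc (w + unitVec κ))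
            * ((Psi (toSite rr) Lc 0 k (delta1 μ₂ z₂) (w + unitVec κ) - bmGaugeAt (toSite rr) (respStep (d := 3) 1 (Lc ^ (k + 1)) μ₂ z₂) Lc (w + unitVec κ))
              - (Psi (toSite rr) Lc 0 k (delta1 μ₂ z₂) w - bmGaugeAt (toSite rr) (respStep (d := 3) 1 (Lc ^ (k + 1)) μ₂ z₂) Lc w)) := tsum_congr fun w => by ring
  rw [e1, e0] at h'
  exact h'

/-- NOT IN PRINT; OUR BOOKKEEPING.  **THE MIDPOINT READING** (`(ψ u + ψ (u+e_κ))∕2`: the owner's `StaircasePairing.abs_pairing_le_sum` slot after `ContactCellSplit.split_mid`) — `exists_pairingAtom_refine_three` at `θ = (½,½)`, summands rewritten by `ring`. -/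
theorem exists_pairingAtomMid_refine_three (hLc : 2 ≤ Lc) :
    ∃ κ₀ K θP : ℝ, 0 < κ₀ ∧ 0 ≤ K ∧ 0 ≤ θP ∧ θP < 1 ∧
      ∀ (rr : Fin (3 + 1) → ℕ), rr ∈ box (3 + 1) Lc →
        ∀ (k : ℕ) (μt : Fin (3 + 1)) (zt : Site (3 + 1)) (μ₁ : Fin (3 + 1)) (z₁ : Site (3 + 1)) (μ₂ : Fin (3 + 1)) (z₂ : Site (3 + 1))
          (κ : Fin (3 + 1)),
          |(Lc : ℝ) ^ (12 * (k + 2)) * (∑' v : Site (3 + 1), contourSumAdj (Lc ^ (k + 2)) (fun κ' y => wΦ (N := Lc ^ (k + 2)) κ' μt (y - zt)) κ v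
            * (((Psi (toSite rr) Lc 0 (k + 1) (delta1 μ₁ z₁) v - bmGaugeAt (toSite rr) (respStep (d := 3) 1 (Lc ^ (k + 2)) μ₁ z₁) Lc v)
              + (Psi (toSite rr) Lc 0 (k + 1) (delta1 μ₁ z₁) (v + unitVec κ) - bmGaugeAt (toSite rr) (respStep (d := 3) 1 (Lc ^ (k + 2)) μ₁ z₁) Lc (v + unitVec κ))) / 2)
            * ((Psi (toSite rr) Lc 0 (k + 1) (delta1 μ₂ z₂) (v + unitVec κ) - bmGaugeAt (toSite rr) (respStep (d := 3) 1 (Lc ^ (k + 2)) μ₂ z₂) Lc (v + unitVec κ))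
              - (Psi (toSite rr) Lc 0 (k + 1) (delta1 μ₂ z₂) v - bmGaugeAt (toSite rr) (respStep (d := 3) 1 (Lc ^ (k + 2)) μ₂ z₂) Lc v)))
            - (Lc : ℝ) ^ (12 * (k + 1)) * (∑' w : Site (3 + 1), contourSumAdj (Lc ^ (k + 1)) (fun κ' y => wΦ (N := Lc ^ (k + 1)) κ' μt (y - zt)) κ w
            * (((Psi (toSite rr) Lc 0 k (delta1 μ₁ z₁) w - bmGaugeAt (toSite rr) (respStep (d := 3) 1 (Lc ^ (k + 1)) μ₁ z₁) Lc w)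
              + (Psi (toSite rr) Lc 0 k (delta1 μ₁ z₁) (w + unitVec κ) - bmGaugeAt (toSite rr) (respStep (d := 3) 1 (Lc ^ (k + 1)) μ₁ z₁) Lc (w + unitVec κ))) / 2)
            * ((Psi (toSite rr) Lc 0 k (delta1 μ₂ z₂) (w + unitVec κ) - bmGaugeAt (toSite rr) (respStep (d := 3) 1 (Lc ^ (k + 1)) μ₂ z₂) Lc (w + unitVec κ))
              - (Psi (toSite rr) Lc 0 k (delta1 μ₂ z₂) w - bmGaugeAt (toSite rr) (respStep (d := 3) 1 (Lc ^ (k + 1)) μ₂ z₂) Lc w)))|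
            ≤ K * θP ^ k * Real.exp (-(κ₀ / 12) * (supNorm (z₁ - zt) + supNorm (z₂ - zt))) := by
  obtain ⟨κ₀, K, θP, hκ, hK, hθP0, hθP1, h⟩ := exists_pairingAtom_refine_three (Lc := Lc) hLc
  refine ⟨κ₀, K, θP, hκ, hK, hθP0, hθP1, fun rr hrr k μt zt μ₁ z₁ μ₂ z₂ κ => ?_⟩
  have hθr : |(1 / 2 : ℝ)| + |(1 / 2 : ℝ)| ≤ 1 := by norm_num
  have h' := h rr hrr k μt zt μ₁ z₁ μ₂ z₂ (1 / 2) (1 / 2) hθr κ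
  have e1 : (∑' v : Site (3 + 1), contourSumAdj (Lc ^ (k + 2)) (fun κ' y => wΦ (N := Lc ^ (k + 2)) κ' μt (y - zt)) κ v
            * ((1 / 2 : ℝ) * (Psi (toSite rr) Lc 0 (k + 1) (delta1 μ₁ z₁) v - bmGaugeAt (toSite rr) (respStep (d := 3) 1 (Lc ^ (k + 2)) μ₁ z₁) Lc v)
              + (1 / 2 : ℝ) * (Psi (toSite rr) Lc 0 (k + 1) (delta1 μ₁ z₁) (v + unitVec κ) - bmGaugeAt (toSite rr) (respStep (d := 3) 1 (Lc ^ (k + 2)) μ₁ z₁) Lc (v + unitVec κ)))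
            * ((Psi (toSite rr) Lc 0 (k + 1) (delta1 μ₂ z₂) (v + unitVec κ) - bmGaugeAt (toSite rr) (respStep (d := 3) 1 (Lc ^ (k + 2)) μ₂ z₂) Lc (v + unitVec κ))
              - (Psi (toSite rr) Lc 0 (k + 1) (delta1 μ₂ z₂) v - bmGaugeAt (toSite rr) (respStep (d := 3) 1 (Lc ^ (k + 2)) μ₂ z₂) Lc v)))
      = ∑' v : Site (3 + 1), contourSumAdj (Lc ^ (k + 2)) (fun κ' y => wΦ (N := Lc ^ (k + 2)) κ' μt (y - zt)) κ v
            * (((Psi (toSite rr) Lc 0 (k + 1) (delta1 μ₁ z₁) v - bmGaugeAt (toSite rr) (respStep (d := 3) 1 (Lc ^ (k + 2)) μ₁ z₁) Lc v)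
              + (Psi (toSite rr) Lc 0 (k + 1) (delta1 μ₁ z₁) (v + unitVec κ) - bmGaugeAt (toSite rr) (respStep (d := 3) 1 (Lc ^ (k + 2)) μ₁ z₁) Lc (v + unitVec κ))) / 2)
            * ((Psi (toSite rr) Lc 0 (k + 1) (delta1 μ₂ z₂) (v + unitVec κ) - bmGaugeAt (toSite rr) (respStep (d := 3) 1 (Lc ^ (k + 2)) μ₂ z₂) Lc (v + unitVec κ))
              - (Psi (toSite rr) Lc 0 (k + 1) (delta1 μ₂ z₂) v - bmGaugeAt (toSite rr) (respStep (d := 3) 1 (Lc ^ (k + 2)) μ₂ z₂) Lc v)) := tsum_congr fun v => by ring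
  have e0 : (∑' w : Site (3 + 1), contourSumAdj (Lc ^ (k + 1)) (fun κ' y => wΦ (N := Lc ^ (k + 1)) κ' μt (y - zt)) κ w
            * ((1 / 2 : ℝ) * (Psi (toSite rr) Lc 0 k (delta1 μ₁ z₁) w - bmGaugeAt (toSite rr) (respStep (d := 3) 1 (Lc ^ (k + 1)) μ₁ z₁) Lc w)
              + (1 / 2 : ℝ) * (Psi (toSite rr) Lc 0 k (delta1 μ₁ z₁) (w + unitVec κ) - bmGaugeAt (toSite rr) (respStep (d := 3) 1 (Lc ^ (k + 1)) μ₁ z₁) Lc (w + unitVec κ)))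
            * ((Psi (toSite rr) Lc 0 k (delta1 μ₂ z₂) (w + unitVec κ) - bmGaugeAt (toSite rr) (respStep (d := 3) 1 (Lc ^ (k + 1)) μ₂ z₂) Lc (w + unitVec κ))
              - (Psi (toSite rr) Lc 0 k (delta1 μ₂ z₂) w - bmGaugeAt (toSite rr) (respStep (d := 3) 1 (Lc ^ (k + 1)) μ₂ z₂) Lc w)))
      = ∑' w : Site (3 + 1), contourSumAdj (Lc ^ (k + 1)) (fun κ' y => wΦ (N := Lc ^ (k + 1)) κ' μt (y - zt)) κ w
            * (((Psi (toSite rr) Lc 0 k (delta1 μ₁ z₁) w - bmGaugeAt (toSite rr) (respStep (d := 3) 1 (Lc ^ (k + 1)) μ₁ z₁) Lc w)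
              + (Psi (toSite rr) Lc 0 k (delta1 μ₁ z₁) (w + unitVec κ) - bmGaugeAt (toSite rr) (respStep (d := 3) 1 (Lc ^ (k + 1)) μ₁ z₁) Lc (w + unitVec κ))) / 2)
            * ((Psi (toSite rr) Lc 0 k (delta1 μ₂ z₂) (w + unitVec κ) - bmGaugeAt (toSite rr) (respStep (d := 3) 1 (Lc ^ (k + 1)) μ₂ z₂) Lc (w + unitVec κ))
              - (Psi (toSite rr) Lc 0 k (delta1 μ₂ z₂) w - bmGaugeAt (toSite rr) (respStep (d := 3) 1 (Lc ^ (k + 1)) μ₂ z₂) Lc w)) := tsum_congr fun w => by ring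
  rw [e1, e0] at h'
  exact h'

end Summit.QuantumFields.BalabanUV.Beta.GAN24.ContactRefinePThreePack

end
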